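import Summits.AtomisticToContinuum.HydrodynamicLimit.Theses.SinaiSteeringDichotomy

/-!
# Skeleton line `phase-split` — crux `ActiveEnergyClosureCost` (stmt-AtomisticToContinuum-9506, route SinaiSteeringDichotomy)

The crux-strategist decomposition D1 (STRATEGY-CENSUS.md), in REGISTERED-SKELETON form: the crux's bad event
`cap ∧ δ<|D^E_N| ∧ ¬Deficit_(α,κ)` is cut by the ball-PACKING predicate `Pack(η₁) := ∀ r ∈ [s,s+τ] ∀ x, ρ^(ℓ)_N(r,x)·σ³ ≤ η₁`.

* `stub_inBandActiveEnergyClosureCost` — its statement is, BY NAME, the route item `InBandActiveEnergyClosureCost`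
  (stmt-AtomisticToContinuum-18766, rendered route rev 19; = the refuter's repaired C′ of REVIEW.md F1): the in-band,
  collision-active, speed-capped cost. OPEN (open-problem); its own birth skeleton is `Lines/inband-birth.lean`.
* `stub_outOfBandActiveEnergyClosureCost` — the remainder on `¬Pack(η₁)` for every `η₁ > 0` (same `∀δ ∃(α,κ) ∀M`
  shape). EXPECTED FALSE as typed: this is exactly where the standing suspect-false witness of the crux lives (boosted
  strained-crystal inclusion, `G`-cost `e^(-O(N))`, REVIEW.md F1). It is a CONSEQUENCE of the crux (`outOfBand_of_crux`),
  so refuting it refutes the crux; stub-workers: treat it as a REFUTATION target, not a proof target.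
* `ActiveEnergyClosureCost_of_stubs` (hypothesis form, sorry-free, axioms propext/Classical.choice/Quot.sound) and
  `ActiveEnergyClosureCost_of : <crux BY NAME>` from the two declared stubs: `σ₀ := min`; `(α,κ) := (min,min)` via
  `deficitPred_mono` (the mass-weighted relative Deficit predicate is ANTITONE in `(α,κ)`, from `pred ≥ 0`); both
  stubs at `M+1`; pointwise `by_cases Pack`; `union_half_budget` (`measure_union_le`, `2e^(-(M+1)(N+1)) ≤ e^(-M(N+1))`).
* Documentation of the partition: `inBand_of_crux`, `outOfBand_of_crux`, `crux_iff_inBand_and_outOfBand`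
  (`X ↔ X₁ ∧ X₂`; each stub strictly weaker than the crux in content; BC3 probes stub→crux / stub→Statement 12/12 FAIL,
  SPLIT-PROBES.md).

Disproof used: no `Disproof.lean` for this crux (2026-08-17); the refuter evidence REVIEW.md F1 is honoured by
LOCALISATION into `stub_outOfBandActiveEnergyClosureCost`. Negatives index (20 entries): no stub equals or trivially
restates a refuted statement. Sources: KipnisLandim1999 Ch. 10; Spohn1991 Part I Ch. 3; OllaVaradhanYau1993 §1.
-/

noncomputable section

open MeasureTheory Set Filter
open scoped ENNReal

namespace Summit.AtomisticToContinuum.HydrodynamicLimit.Cruxes.ActiveEnergyClosureCost.PhaseSplit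

open Summit.AtomisticToContinuum.HydrodynamicLimit.Theses.SinaiSteeringDichotomy

/-- Local alias of the crux (the route decl, BY NAME). -/
def CruxStatement : Prop :=
  Summit.AtomisticToContinuum.HydrodynamicLimit.Theses.SinaiSteeringDichotomy.ActiveEnergyClosureCost

theorem cruxStatement_iff :
    CruxStatement ↔ Summit.AtomisticToContinuum.HydrodynamicLimit.Theses.SinaiSteeringDichotomy.ActiveEnergyClosureCost :=
  Iff.rfl

/-- Statement of stub 2 — the OUT-OF-BAND REMAINDER (X₂; believed FALSE as typed, see the module docstring). -/
def OutOfBandStatement : Prop :=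
  ∀ η₁ : ℝ, 0 < η₁ → ∃ σ₀ : ℝ, 0 < σ₀ ∧ ∀ σ : ℝ, 0 < σ → σ < σ₀ → ∀ θe : ℝ, 0 < θe → ∀ Φ : (N : ℕ) → Literature.Analysis.FluidPDE.HardSphereFlow (Literature.Analysis.FluidPDE.Torus.geometry (Fin 3)) (Literature.MathematicalPhysics.KineticTheory.hsDiameter σ N) (N + 1), ∀ (s τ : ℝ), 0 ≤ s → 0 < τ → ∀ φ : ℝ → Literature.MathematicalPhysics.KineticTheory.T3 → ℝ, Literature.Analysis.FunctionSpaces.Torus.IsSmoothSpaceTimeOn (Set.Icc s (s + τ)) φ → ∀ δ : ℝ, 0 < δ → ∃ α κ : ℝ, 0 < α ∧ 0 < κ ∧ κ < 1 ∧ ∀ M : ℝ, ∀ᶠ N : ℕ in Filter.atTop, Literature.MathematicalPhysics.KineticTheory.localGibbsLaw σ (fun _ => 1) (fun _ => 0) (fun _ => θe) N (Φ N) {z | (∀ r ∈ Set.Icc s (s + τ), ∀ i, ‖((Φ N).flow r z i).2‖ ≤ ((N + 1 : ℕ) : ℝ) ^ (1 / 24 : ℝ)) ∧ ¬ (∀ r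 ∈ Set.Icc s (s + τ), ∀ x : Literature.MathematicalPhysics.KineticTheory.T3, Literature.MathematicalPhysics.KineticTheory.empiricalDensityField ((Φ N).flow r z) (fun y => if Literature.Analysis.FluidPDE.Torus.euclidDist x y < ((N + 1 : ℕ) : ℝ) ^ (-(1 / 4 : ℝ)) then (4 / 3 * Real.pi * (((N + 1 : ℕ) : ℝ) ^ (-(1 / 4 : ℝ))) ^ 3)⁻¹ else 0) * σ ^ 3 ≤ η₁) ∧ δ < |(let ℓ : ℝ := ((N + 1 : ℕ) : ℝ) ^ (-(1 / 4 : ℝ)); let χ : Literature.MathematicalPhysics.KineticTheory.T3 → Literature.MathematicalPhysics.KineticTheory.T3 → ℝ := fun x y => if Literature.Analysis.FluidPDE.Torus.euclidDist x y < ℓ then (4 / 3 * Real.pi * ℓ ^ 3)⁻¹ else 0; let ρ : ℝ → Literature.MathematicalPhysics.KineticTheory.T3 → ℝ := fun r x => Literature.MathematicalPhysics.KineticTheory.empiricalDensityField ((Φ N).flow r z) (χ x); let m : ℝ → Literature.MathematicalPhysics.KineticTheory.T3 → Literature.MathematicalPhysics.KineticTheory.V3 := fun r x => Literature.MathematicalPhysics.KineticTheory.empiricalMomentumField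 ((Φ N).flow r z) (χ x); let e : ℝ → Literature.MathematicalPhysics.KineticTheory.T3 → ℝ := fun r x => Literature.MathematicalPhysics.KineticTheory.empiricalEnergyField ((Φ N).flow r z) (χ x); let p : ℝ → Literature.MathematicalPhysics.KineticTheory.T3 → ℝ := fun r x => Literature.MathematicalPhysics.KineticTheory.hsPressure σ (ρ r x) (2 / 3 * (e r x / ρ r x - ‖m r x‖ ^ 2 / (2 * ρ r x ^ 2))); let Et : ℝ → (Literature.MathematicalPhysics.KineticTheory.T3 → ℝ) → ℝ := fun r g => Literature.MathematicalPhysics.KineticTheory.empiricalEnergyField ((Φ N).flow r z) g; Et (s + τ) (φ (s + τ)) - Et s (φ s) - ∫ r in s..(s + τ), (Et r (Literature.Analysis.FunctionSpaces.Torus.timeDerivWithin (Set.Icc s (s + τ)) φ r) + ∫ x, (e r x + p r x) * (∑ i, (m r x i / ρ r x) * (Literature.Analysis.FunctionSpaces.Torus.gradient (φ r) x) i)))| ∧ ¬ (let ℓ : ℝ := ((N + 1 : ℕ) : ℝ) ^ (-(1 / 4 : ℝ)); let χ : Literature.MathematicalPhysics.KineticTheory.T3 → Literature.MathematicalPhysics.KineticTheory.T3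 → ℝ := fun x y => if Literature.Analysis.FluidPDE.Torus.euclidDist x y < ℓ then (4 / 3 * Real.pi * ℓ ^ 3)⁻¹ else 0; let ρ := fun r x => Literature.MathematicalPhysics.KineticTheory.empiricalDensityField ((Φ N).flow r z) (χ x); let θ := fun r x => 2 / 3 * (Literature.MathematicalPhysics.KineticTheory.empiricalEnergyField ((Φ N).flow r z) (χ x) / ρ r x - ‖Literature.MathematicalPhysics.KineticTheory.empiricalMomentumField ((Φ N).flow r z) (χ x)‖ ^ 2 / (2 * ρ r x ^ 2)); let cnt := fun x => Set.ncard {r : ℝ | r ∈ Set.Icc s (s + τ) ∧ ∃ i j : Fin (N + 1), i ≠ j ∧ (Φ N).flow r z ∈ Literature.Analysis.FluidPDE.contactSet (Literature.Analysis.FluidPDE.Torus.geometry (Fin 3)) (N + 1) (Literature.MathematicalPhysics.KineticTheory.hsDiameter σ N) i j ∧ Literature.Analysis.FluidPDE.Torus.euclidDist ((Φ N).flow r z i).1 x < ℓ}; let pred := fun x => 8 / 3 * Real.pi ^ (3 / 2 : ℝ) * σ ^ 2 * ((N + 1 : ℕ) : ℝ) ^ (4 / 3 : ℝ) * ℓ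 ^ 3 * ∫ r in s..(s + τ), ρ r x ^ 2 * Real.sqrt (θ r x); ENNReal.ofReal α ≤ ∫⁻ x in {x : Literature.MathematicalPhysics.KineticTheory.T3 | (cnt x : ℝ) ≤ (1 - κ) * pred x}, ENNReal.ofReal (τ⁻¹ * ∫ r in s..(s + τ), ρ r x))} ≤ ENNReal.ofReal (Real.exp (-(M * (N + 1))))

/-! ### Registered stubs -/

/-- **stub 1 — the in-band piece IS the route item `InBandActiveEnergyClosureCost` (stmt-18766), by name.** -/
theorem stub_inBandActiveEnergyClosureCost :
    Summit.AtomisticToContinuum.HydrodynamicLimit.Theses.SinaiSteeringDichotomy.InBandActiveEnergyClosureCost := by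
  sorry

/-- **stub 2 — the out-of-band remainder (REFUTATION TARGET; expected false: the strained-crystal witness).** -/
theorem stub_outOfBandActiveEnergyClosureCost : OutOfBandStatement := by
  sorry

/-! ### Glue (sorry-free) -/

/-- The crux's (mass-weighted, relative) collision-DEFICIT predicate `Deficit_(α,κ)(z)` for one flow
`Φ` — verbatim the `let`-block negated in the last conjunct of the crux's event. -/
def deficitPred (σ : ℝ) (N : ℕ)
    (Φ : Literature.Analysis.FluidPDE.HardSphereFlow (Literature.Analysis.FluidPDE.Torus.geometry (Fin 3))
      (Literature.MathematicalPhysics.KineticTheory.hsDiameter σ N) (N + 1))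
    (s τ α κ : ℝ)
    (z : Literature.Analysis.FluidPDE.Config (N + 1) (Fin 3) Literature.MathematicalPhysics.KineticTheory.T3) :
    Prop :=
  let ℓ : ℝ := ((N + 1 : ℕ) : ℝ) ^ (-(1 / 4 : ℝ)); let χ : Literature.MathematicalPhysics.KineticTheory.T3 → Literature.MathematicalPhysics.KineticTheory.T3 → ℝ := fun x y => if Literature.Analysis.FluidPDE.Torus.euclidDist x y < ℓ then (4 / 3 * Real.pi * ℓ ^ 3)⁻¹ else 0; let ρ := fun r x => Literature.MathematicalPhysics.KineticTheory.empiricalDensityField (Φ.flow r z) (χ x); let θ := fun r x => 2 / 3 * (Literature.MathematicalPhysics.KineticTheory.empiricalEnergyField (Φ.flow r z) (χ x) / ρ r x - ‖Literature.MathematicalPhysics.KineticTheory.empiricalMomentumField (Φ.flow r z) (χ x)‖ ^ 2 / (2 * ρ r x ^ 2)); let cnt := fun x => Set.ncard {r : ℝ | r ∈ Set.Icc s (s + τ) ∧ ∃ i j : Fin (N + 1), i ≠ j ∧ Φ.flow r z ∈ Literature.Analysis.FluidPDE.contactSet (Literature.Analysis.FluidPDE.Torus.geometry (Fin 3)) (N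 + 1) (Literature.MathematicalPhysics.KineticTheory.hsDiameter σ N) i j ∧ Literature.Analysis.FluidPDE.Torus.euclidDist (Φ.flow r z i).1 x < ℓ}; let pred := fun x => 8 / 3 * Real.pi ^ (3 / 2 : ℝ) * σ ^ 2 * ((N + 1 : ℕ) : ℝ) ^ (4 / 3 : ℝ) * ℓ ^ 3 * ∫ r in s..(s + τ), ρ r x ^ 2 * Real.sqrt (θ r x); ENNReal.ofReal α ≤ ∫⁻ x in {x : Literature.MathematicalPhysics.KineticTheory.T3 | (cnt x : ℝ) ≤ (1 - κ) * pred x}, ENNReal.ofReal (τ⁻¹ * ∫ r in s..(s + τ), ρ r x)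

/-- `Deficit_(α,κ)` is ANTITONE in `(α, κ)`: a larger mass threshold and a deeper relative deficit
are harder to meet (`pred ≥ 0` since `τ > 0`). Hence `¬Deficit` is MONOTONE, which lets the assembly
run both pieces at `(min α₁ α₂, min κ₁ κ₂)`. -/
theorem deficitPred_mono {σ : ℝ} {N : ℕ}
    {Φ : Literature.Analysis.FluidPDE.HardSphereFlow (Literature.Analysis.FluidPDE.Torus.geometry (Fin 3))
      (Literature.MathematicalPhysics.KineticTheory.hsDiameter σ N) (N + 1)}
    {s τ α α' κ κ' : ℝ} (hτ : 0 < τ) (hα : α ≤ α') (hκ : κ ≤ κ')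
    (z : Literature.Analysis.FluidPDE.Config (N + 1) (Fin 3) Literature.MathematicalPhysics.KineticTheory.T3)
    (h : deficitPred σ N Φ s τ α' κ' z) : deficitPred σ N Φ s τ α κ z := by
  dsimp only [deficitPred] at h ⊢
  refine le_trans (ENNReal.ofReal_le_ofReal hα) (le_trans h (lintegral_mono_set ?_))
  intro x hx
  simp only [Set.mem_setOf_eq] at hx ⊢
  refine le_trans hx (mul_le_mul_of_nonneg_right (by linarith) ?_)
  refine mul_nonneg (by positivity) ?_
  refine intervalIntegral.integral_nonneg (by linarith) (fun r _ => ?_)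
  exact mul_nonneg (sq_nonneg _) (Real.sqrt_nonneg _)

/-- Budget arithmetic: two events of mass `≤ e^(-(M+1)(N+1))` cover an event of mass
`≤ e^(-M(N+1))` (`2 ≤ e ≤ e^(N+1)`). -/
theorem union_half_budget {Ω : Type*} [MeasurableSpace Ω] (μ : Measure Ω) (S S₁ S₂ : Set Ω)
    (M : ℝ) (N : ℕ)
    (h₁ : μ S₁ ≤ ENNReal.ofReal (Real.exp (-((M + 1) * ((N : ℝ) + 1)))))
    (h₂ : μ S₂ ≤ ENNReal.ofReal (Real.exp (-((M + 1) * ((N : ℝ) + 1)))))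
    (hsub : S ⊆ S₁ ∪ S₂) :
    μ S ≤ ENNReal.ofReal (Real.exp (-(M * ((N : ℝ) + 1)))) := by
  have hreal : Real.exp (-((M + 1) * ((N : ℝ) + 1))) + Real.exp (-((M + 1) * ((N : ℝ) + 1)))
      ≤ Real.exp (-(M * ((N : ℝ) + 1))) := by
    have hsplit : Real.exp (-((M + 1) * ((N : ℝ) + 1)))
        = Real.exp (-(M * ((N : ℝ) + 1))) * Real.exp (-((N : ℝ) + 1)) := by
      rw [← Real.exp_add]; congr 1; ring
    have hge : (2 : ℝ) ≤ Real.exp ((N : ℝ) + 1) := by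
      have h1 := Real.add_one_le_exp ((N : ℝ) + 1)
      have hN : (0 : ℝ) ≤ (N : ℝ) := Nat.cast_nonneg N
      linarith
    have hinv : Real.exp (-((N : ℝ) + 1)) * Real.exp ((N : ℝ) + 1) = 1 := by
      rw [← Real.exp_add]; simp
    have hsmall : 2 * Real.exp (-((N : ℝ) + 1)) ≤ 1 := by
      have hpos := Real.exp_pos (-((N : ℝ) + 1))
      nlinarith
    have hA := Real.exp_pos (-(M * ((N : ℝ) + 1)))
    rw [hsplit]
    nlinarith
  calc μ S ≤ μ (S₁ ∪ S₂) := measure_mono hsub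
    _ ≤ μ S₁ + μ S₂ := measure_union_le S₁ S₂
    _ ≤ ENNReal.ofReal (Real.exp (-((M + 1) * ((N : ℝ) + 1))))
          + ENNReal.ofReal (Real.exp (-((M + 1) * ((N : ℝ) + 1)))) := add_le_add h₁ h₂
    _ = ENNReal.ofReal (Real.exp (-((M + 1) * ((N : ℝ) + 1)))
          + Real.exp (-((M + 1) * ((N : ℝ) + 1)))) :=
        (ENNReal.ofReal_add (Real.exp_pos _).le (Real.exp_pos _).le).symm
    _ ≤ ENNReal.ofReal (Real.exp (-(M * ((N : ℝ) + 1)))) := ENNReal.ofReal_le_ofReal hreal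

/-- Hypothesis form of the composition (sorry-free): the in-band item and the out-of-band remainder give the crux —
`σ₀ := min`, `(α,κ) := (min, min)` via `deficitPred_mono`, both at `M+1`, case split on `Pack`, union bound. -/
theorem ActiveEnergyClosureCost_of_stubs :
    Summit.AtomisticToContinuum.HydrodynamicLimit.Theses.SinaiSteeringDichotomy.InBandActiveEnergyClosureCost →
      OutOfBandStatement → CruxStatement := by
  rintro ⟨η₁, hη₁, σ₁, hσ₁, H₁⟩ H₂
  show ActiveEnergyClosureCost
  unfold OutOfBandStatement at H₂
  obtain ⟨σ₂, hσ₂, H₂⟩ := H₂ η₁ hη₁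
  refine ⟨min σ₁ σ₂, lt_min hσ₁ hσ₂, ?_⟩
  intro σ hσ hσlt θe hθe Φ s τ hs hτ φ hφ δ hδ
  obtain ⟨α₁, κ₁, hα₁, hκ₁, hκ₁', G₁⟩ :=
    H₁ σ hσ (lt_of_lt_of_le hσlt (min_le_left _ _)) θe hθe Φ s τ hs hτ φ hφ δ hδ
  obtain ⟨α₂, κ₂, hα₂, hκ₂, hκ₂', G₂⟩ :=
    H₂ σ hσ (lt_of_lt_of_le hσlt (min_le_right _ _)) θe hθe Φ s τ hs hτ φ hφ δ hδ
  refine ⟨min α₁ α₂, min κ₁ κ₂, lt_min hα₁ hα₂, lt_min hκ₁ hκ₂,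
    lt_of_le_of_lt (min_le_left _ _) hκ₁', fun M => ?_⟩
  filter_upwards [G₁ (M + 1), G₂ (M + 1)] with N hN₁ hN₂
  refine union_half_budget _ _ _ _ M N hN₁ hN₂ ?_
  intro z hz
  rcases hz with ⟨hcap, hdef, hndef⟩
  have hndef' : ¬ deficitPred σ N (Φ N) s τ (min α₁ α₂) (min κ₁ κ₂) z := hndef
  have hnd₁ : ¬ deficitPred σ N (Φ N) s τ α₁ κ₁ z :=
    fun h => hndef' (deficitPred_mono hτ (min_le_left _ _) (min_le_left _ _) z h)
  have hnd₂ : ¬ deficitPred σ N (Φ N) s τ α₂ κ₂ z :=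
    fun h => hndef' (deficitPred_mono hτ (min_le_right _ _) (min_le_right _ _) z h)
  by_cases hp : (∀ r ∈ Set.Icc s (s + τ), ∀ x : Literature.MathematicalPhysics.KineticTheory.T3, Literature.MathematicalPhysics.KineticTheory.empiricalDensityField ((Φ N).flow r z) (fun y => if Literature.Analysis.FluidPDE.Torus.euclidDist x y < ((N + 1 : ℕ) : ℝ) ^ (-(1 / 4 : ℝ)) then (4 / 3 * Real.pi * (((N + 1 : ℕ) : ℝ) ^ (-(1 / 4 : ℝ))) ^ 3)⁻¹ else 0) * σ ^ 3 ≤ η₁)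
  · exact Or.inl ⟨hcap, hp, hdef, hnd₁⟩
  · exact Or.inr ⟨hcap, hp, hdef, hnd₂⟩


/-- **Assembly (the skeleton theorem): the crux BY NAME from the two declared stubs.** -/
theorem ActiveEnergyClosureCost_of :
    Summit.AtomisticToContinuum.HydrodynamicLimit.Theses.SinaiSteeringDichotomy.ActiveEnergyClosureCost :=
  ActiveEnergyClosureCost_of_stubs stub_inBandActiveEnergyClosureCost stub_outOfBandActiveEnergyClosureCost

/-! ### The partition (documentation) -/

/-- Converse 1 (documentation of the partition): the crux implies its in-band piece (`η₁ := 1`;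
drop the packing conjunct). -/
theorem inBand_of_crux : CruxStatement →
    Summit.AtomisticToContinuum.HydrodynamicLimit.Theses.SinaiSteeringDichotomy.InBandActiveEnergyClosureCost := by
  unfold CruxStatement
  rintro ⟨σ₀, hσ₀, H⟩
  refine ⟨1, one_pos, σ₀, hσ₀, ?_⟩
  intro σ hσ hσlt θe hθe Φ s τ hs hτ φ hφ δ hδ
  obtain ⟨α, κ, hα, hκ, hκ', G⟩ := H σ hσ hσlt θe hθe Φ s τ hs hτ φ hφ δ hδ
  refine ⟨α, κ, hα, hκ, hκ', fun M => ?_⟩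
  filter_upwards [G M] with N hN
  refine le_trans (measure_mono ?_) hN
  rintro z ⟨hcap, -, hdef, hndef⟩
  exact ⟨hcap, hdef, hndef⟩

/-- Converse 2 (documentation of the partition): the crux implies its out-of-band remainder (drop
the `¬ Pack` conjunct). Consequently a refutation of X₂ refutes the crux. -/
theorem outOfBand_of_crux : CruxStatement → OutOfBandStatement := by
  unfold CruxStatement OutOfBandStatement
  rintro ⟨σ₀, hσ₀, H⟩ η₁ _hη₁
  refine ⟨σ₀, hσ₀, ?_⟩
  intro σ hσ hσlt θe hθe Φ s τ hs hτ φ hφ δ hδ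
  obtain ⟨α, κ, hα, hκ, hκ', G⟩ := H σ hσ hσlt θe hθe Φ s τ hs hτ φ hφ δ hδ
  refine ⟨α, κ, hα, hκ, hκ', fun M => ?_⟩
  filter_upwards [G M] with N hN
  refine le_trans (measure_mono ?_) hN
  rintro z ⟨hcap, -, hdef, hndef⟩
  exact ⟨hcap, hdef, hndef⟩

/-- The partition in one line: `X ↔ X₁ ∧ X₂`. -/
theorem crux_iff_inBand_and_outOfBand :
    CruxStatement ↔ (Summit.AtomisticToContinuum.HydrodynamicLimit.Theses.SinaiSteeringDichotomy.InBandActiveEnergyClosureCost ∧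
      OutOfBandStatement) :=
  ⟨fun h => ⟨inBand_of_crux h, outOfBand_of_crux h⟩, fun h => ActiveEnergyClosureCost_of_stubs h.1 h.2⟩



end Summit.AtomisticToContinuum.HydrodynamicLimit.Cruxes.ActiveEnergyClosureCost.PhaseSplit
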